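import Summits.QuantumFields.BalabanUV.T4Continuum.Support.RegionLocalInjectedPairing
import Summits.QuantumFields.BalabanUV.T4Continuum.Support.RegionMassTwoLevel
import Summits.QuantumFields.BalabanUV.T4Continuum.Support.RegionElectricSplitting
import Summits.QuantumFields.BalabanUV.T4Continuum.Support.RegionGramTwoLevel

/-!
# T⁴ programme, spine node NE2 (U1a), sub-row Δ1 «NE2⁰-Dirichlet» — THE MASTER BUDGET OF THE LOCAL OPERATOR AND THE ASSEMBLY OF
# LEAF (L): (P-mass) consumed BY NAME, the Gaffney pairing (P-W) in ONE fixed currency, the Hessian budget (R-loc) displayed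
# (owner item O15-c «Δ1-VEC-W3-LOCAL-ASSEMBLY»)

Row NE2 OWNER (unit `b2b-balaban-t4-ne2-p1`, gen 15), on O15-a/b (`RegionGaugeResolventSplit` p238371, `RegionGaugeResolventTower` p238533,
`RegionLocalInjectedPairing` p238678) and the crew's landed pieces: leaf-07-g8's (P-mass) END `RegionMassTwoLevel.mass_pairing_le` (p238605:
`‖⟨v, (J·m_k − m_{k+1}·J)u⟩‖ ≤ 4a(√L)^{−k}·√nsq u·√nsq v`) and leaf-02-g8's electric splitting `RegionElectricSplitting.Wdir` (p238744).
Rulings R35/R36 (journal 2026-08-20 l.22128 / l.22328).  THIS FILE fixes the interface of the two remaining sub-pieces of (L):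

 * §1 THE MASTER BUDGET `Ebud n M a S u := nsq u + Re⟨u, Δ_loc u⟩ + Σ_μ nsq (Wdir μ u) + nsq (Δ_loc u)` (mass, the electric+mass FORM — it
   contains the interior gradients AND the transverse boundary charges —, leaf-02-g8's directional Hessian pieces, and the graph norm, which is
   FREE for `u = G̃f`), `Ebud_nonneg`, and **`budget_Ebud`**: `Δ_a(Ω₀)` γ-coercive ⟹ `√Ebud(G̃f) ≤ √(γ⁻² + γ⁻¹ + CH² + 1)·√nsq f` MODULO the
   displayed Hessian budget (R-loc) `hRH : ∀ f, Σ_μ nsq (Wdir μ (G̃f)) ≤ CH²·nsq f` (leaf-02-g8's «Δ1-LOC-HESS» END discharges it).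
 * §2 **`hloc_of_WPairing`**: leaf (L) of `hinjK_of_local` from ONE displayed pairing in the master currency —
   (P-W) `∀ k u v, ‖⟨v, (JpR k·Δ_loc^{(k)}(a := 0) − Δ_loc^{(k+1)}(a := 0)·JpR k)u⟩‖ ≤ εW k·√Ebud_k(u)·√Ebud_{k+1}(v)` (the GAFFNEY part
   `curlRᴴcurlR + ∂_Ω∂_Ωᴴ` IS `regionDeltaLoc … 0 …`; leaf-03-g8's «W3-GAFFNEY-PAIRING») — plus (R-loc); the mass part is leaf-07-g8's theorem,
   added by `pairing_add` (`loc_comm_eq`); `εW k ≤ CW·θ^k` with θ ≥ (√L)⁻¹ ⟹ `hloc` with the constant `ClW = (CW + 4a)·(Λ + γ⋆⁻¹)²`.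
 * §3 **LEAF (K) IS A THEOREM** (leaf-01-g10's `RegionGramTwoLevel.opNorm_KcompR_inv_sub_le_lev`, p238963, rate L⁻¹, re-read at every
   θ ≥ L⁻¹: `hK_box`), and the END **`towerLimitRate_star_renorm_box_of_WPairing`**: the renormalised star tower of the faithful `Δ_a(Ω₀)` on a
   coordinate box at rate θ ∈ [(√L)⁻¹, 1) MODULO exactly: (P-W) [leaf-03-g8], (R-loc) [leaf-02-g8], (B)/(Bᵗ) [leaf-05-g9] — (K) discharged.

HONEST FRAMING (T4-DAG p. 1).  Bookkeeping over landed modules ([folklore]); model level (`U = 1`, ONE region = a coordinate box, ONE averaging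
scale, finite torus, linear layer, operator norm); (P-W), (R-loc), (B), (Bᵗ) DISPLAYED, not proved; (K) proved by leaf-01-g10; `hinjK` / W3 on boxes OPEN; NE2 (U1a) NOT proved;
spine PROVED 0/9 unchanged; NOT [B9] (3.16)/(3.23)–(3.27)/(3.42) as printed; NOT infinite volume / mass gap / Clay.  HONEST DEPENDENCY: continuum YM on
T⁴ ⇐ BetaPertH ∧ nine spine estimates (0/9 proved); BetaPertH ⇐ (D1) ∧ (D4) ∧ CAP+tail; G-an2-4 gates asym, D1 and NE2/3/4.  No `sorry`.
-/

noncomputable section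

open scoped BigOperators ComplexConjugate Matrix Matrix.Norms.L2Operator

namespace Summit.QuantumFields.BalabanUV.T4Continuum.RegionLocalInjectedAssembly

open Literature.MathematicalPhysics.QuantumFieldTheory.Balaban1983to89.B5Prop11Plancherel (Tor fine)
open Literature.MathematicalPhysics.QuantumFieldTheory.Balaban1983to89.B5Prop11Lower (nsq nsq_nonneg nsq_mulVec_le)
open Literature.MathematicalPhysics.QuantumFieldTheory.Balaban1983to89.B5G183RateUnitTower (lev)
open Summit.QuantumFields.BalabanUV.T4Continuum
open Summit.QuantumFields.BalabanUV.T4Continuum.SubtypeCompression (Coercive isUnit_det_of_coercive opNorm_inv_le_of_coercive)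
open Summit.QuantumFields.BalabanUV.T4Continuum.CovariantAveragingTower (TowerLimitRate)
open Summit.QuantumFields.BalabanUV.T4Continuum.BackgroundResolventTower (Cpert)
open Summit.QuantumFields.BalabanUV.T4Continuum.RegionGaugeSlice (re_form_le_opNorm)
open Summit.QuantumFields.BalabanUV.T4Continuum.RegionScalarCompression (KcompR)
open Summit.QuantumFields.BalabanUV.T4Continuum.RegionGaugeFixedVector (starReg curlR gradR avgR regionDeltaA)
open Summit.QuantumFields.BalabanUV.T4Continuum.DirichletSubregionTowerOf (pidx JpR)
open Summit.QuantumFields.BalabanUV.T4Continuum.DirichletSubregionRenormTower (AnR)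
open Summit.QuantumFields.BalabanUV.T4Continuum.DirichletStarVectorTower (starP gamStar gamStar_pos)
open Summit.QuantumFields.BalabanUV.T4Continuum.RegionInteriorW2 (CgIbox)
open Summit.QuantumFields.BalabanUV.T4Continuum.RegionSliceCoerciveBoxTower (cW1box cW1box_pos)
open Summit.QuantumFields.BalabanUV.T4Continuum.RegionStarPairingBricks (pairing_add budget_add)
open Summit.QuantumFields.BalabanUV.T4Continuum.RegionElectricSplitting (Wdir)
open Summit.QuantumFields.BalabanUV.T4Continuum.RegionMassTwoLevel (mass_pairing_le)
open Summit.QuantumFields.BalabanUV.T4Continuum.RegionGramTwoLevel (opNorm_KcompR_inv_sub_le_lev Cgram_nonneg)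
open Summit.QuantumFields.BalabanUV.T4Continuum.ScalarAveragedPropagator (gammaPs)
open Summit.QuantumFields.BalabanUV.T4Continuum.ScalarAveragedCompression (sigma0)
open Summit.QuantumFields.BalabanUV.Beta.GAN24.DirichletBoxTwoLevel (Cbox)
open Summit.QuantumFields.BalabanUV.T4Continuum.RegionGaugeResolventSplit
open Summit.QuantumFields.BalabanUV.T4Continuum.RegionGaugeResolventTower (C1loc towerLimitRate_star_renorm_box_of_local)
open Summit.QuantumFields.BalabanUV.T4Continuum.RegionLocalInjectedPairing (coercive_regionDeltaLoc_lev_box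
  opNorm_inv_regionDeltaLoc_lev_box_le hloc_of_pairing)
open Summit.QuantumFields.BalabanUV.Beta.GAN24.DirichletBoxTwoLevel (IsCoordBox)

variable {d : ℕ}

/-! ## §1 The master budget of the local operator -/

section Budget

variable (n : ℕ) [NeZero n] (M : Fin d → ℕ) [hM : ∀ μ, NeZero (M μ)] (a : ℝ) (S : Tor M → Prop) [DecidablePred S]

/-- **THE MASTER BUDGET** `E(u) = nsq u + Re⟨u, Δ_loc u⟩ + Σ_μ nsq (W_μ u) + nsq (Δ_loc u)`: mass, the local FORM (interior gradients + transverse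
boundary charges + line mass), the directional Hessian pieces, the graph norm. [folklore] -/
def Ebud (u : {b // starReg n M S b} → ℂ) : ℝ :=
  nsq u + (star u ⬝ᵥ (regionDeltaLoc n M a S *ᵥ u)).re + ∑ μ, nsq (Wdir n M S μ *ᵥ u) + nsq (regionDeltaLoc n M a S *ᵥ u)

/-- the local form is nonnegative for `0 ≤ a`. [folklore] -/
theorem form_regionDeltaLoc_nonneg (ha : 0 ≤ a) (u : {b // starReg n M S b} → ℂ) :
    0 ≤ (star u ⬝ᵥ (regionDeltaLoc n M a S *ᵥ u)).re := by
  rw [regionDeltaLoc, form_localFixed]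
  have := nsq_nonneg (curlR n M S *ᵥ u); have := nsq_nonneg ((gradR n M S)ᴴ *ᵥ u); have := nsq_nonneg (avgR n M S *ᵥ u)
  have : 0 ≤ a * (n : ℝ) ^ d := mul_nonneg ha (pow_nonneg (Nat.cast_nonneg _) d)
  positivity

/-- the master budget is nonnegative (`0 ≤ a`). [folklore] -/
theorem Ebud_nonneg (ha : 0 ≤ a) (u : {b // starReg n M S b} → ℂ) : 0 ≤ Ebud n M a S u :=
  add_nonneg (add_nonneg (add_nonneg (nsq_nonneg u) (form_regionDeltaLoc_nonneg n M a S ha u))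
    (Finset.sum_nonneg fun μ _ => nsq_nonneg (Wdir n M S μ *ᵥ u))) (nsq_nonneg (regionDeltaLoc n M a S *ᵥ u))

/-- **(R̃) FOR THE MASTER BUDGET, MODULO (R-loc)**: `Δ_a(Ω₀)` γ-coercive (`0 < a′`, `0 < γ`) and the directional Hessian budget
`Σ_μ nsq (W_μ (G̃f)) ≤ CH²·nsq f` ⟹ `√E(G̃f) ≤ √(γ⁻² + γ⁻¹ + CH² + 1)·√nsq f`. [folklore] -/
theorem budget_Ebud {a' : ℝ} (ha' : 0 < a') {γ : ℝ} (hγ : 0 < γ) (hco : Coercive (regionDeltaA n M a a' S) γ) {CH : ℝ}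
    (hRH : ∀ f, ∑ μ, nsq (Wdir n M S μ *ᵥ ((regionDeltaLoc n M a S)⁻¹ *ᵥ f)) ≤ CH ^ 2 * nsq f)
    (f : {b // starReg n M S b} → ℂ) :
    Real.sqrt (Ebud n M a S ((regionDeltaLoc n M a S)⁻¹ *ᵥ f)) ≤ Real.sqrt (γ⁻¹ ^ 2 + γ⁻¹ + CH ^ 2 + 1) * Real.sqrt (nsq f) := by
  obtain ⟨hU, hG⟩ := opNorm_inv_regionDeltaLoc_le n M a a' S ha' hγ hco
  set u := (regionDeltaLoc n M a S)⁻¹ *ᵥ f with hu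
  have e1 : regionDeltaLoc n M a S *ᵥ u = f := by rw [hu, Matrix.mulVec_mulVec, Matrix.mul_nonsing_inv _ hU, Matrix.one_mulVec]
  have h1 : nsq u ≤ γ⁻¹ ^ 2 * nsq f :=
    (nsq_mulVec_le _ f).trans (mul_le_mul_of_nonneg_right (pow_le_pow_left₀ (norm_nonneg _) hG 2) (nsq_nonneg f))
  have h2 : (star u ⬝ᵥ (regionDeltaLoc n M a S *ᵥ u)).re ≤ γ⁻¹ * nsq f := by
    rw [e1]; exact (re_form_le_opNorm _ f).trans (mul_le_mul_of_nonneg_right hG (nsq_nonneg f))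
  have h3 := hRH f
  have h4 : nsq (regionDeltaLoc n M a S *ᵥ u) = nsq f := by rw [e1]
  rw [← Real.sqrt_mul (by positivity)]
  refine Real.sqrt_le_sqrt ?_
  unfold Ebud
  rw [h4]
  nlinarith [nsq_nonneg f]

end Budget

/-! ## §2 Leaf (L) from the Gaffney pairing in the master currency + (R-loc), with (P-mass) by name -/

section Tower

variable (L : ℕ) [NeZero L] (M : Fin d → ℕ) [hM : ∀ μ, NeZero (M μ)] (S : Tor M → Prop) [DecidablePred S] (a a' : ℝ)

/-- the budget constant `Λ = √(γ⋆⁻² + γ⋆⁻¹ + CH² + 1)` on boxes. [folklore] -/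
def LamLoc (d : ℕ) (a a' CH : ℝ) : ℝ :=
  Real.sqrt ((gamStar d a' (cW1box d a a' 4))⁻¹ ^ 2 + (gamStar d a' (cW1box d a a' 4))⁻¹ + CH ^ 2 + 1)

/-- the constant of leaf (L): `(CW + 4a)·(Λ + γ⋆⁻¹)²` (the mass part runs on the `nsq` budget, `Λ_mass = γ⋆⁻¹`). [folklore] -/
def ClW (d : ℕ) (a a' CW CH : ℝ) : ℝ :=
  (CW + 4 * a) * (LamLoc d a a' CH + (gamStar d a' (cW1box d a a' 4))⁻¹) * (LamLoc d a a' CH + (gamStar d a' (cW1box d a a' 4))⁻¹)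

/-- the Gaffney part plus the mass part is the local commutator (`Δ_loc(a) = Δ_loc(0) + m(a)` at both levels). [folklore] -/
theorem loc_comm_eq (k : ℕ) :
    JpR L M (starP L M S) k * regionDeltaLoc (lev L k) M a S - regionDeltaLoc (lev L (k + 1)) M a S * JpR L M (starP L M S) k
      = (JpR L M (starP L M S) k * regionDeltaLoc (lev L k) M 0 S - regionDeltaLoc (lev L (k + 1)) M 0 S * JpR L M (starP L M S) k)
        + (JpR L M (starP L M S) k * ((((a * ((lev L k : ℕ) : ℝ) ^ d : ℝ)) : ℂ) • ((avgR (lev L k) M S)ᴴ * avgR (lev L k) M S))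
          - ((((a * ((lev L (k + 1) : ℕ) : ℝ) ^ d : ℝ)) : ℂ) • ((avgR (lev L (k + 1)) M S)ᴴ * avgR (lev L (k + 1)) M S))
            * JpR L M (starP L M S) k) := by
  simp only [regionDeltaLoc_eq, zero_mul, Complex.ofReal_zero, zero_smul, add_zero, Matrix.mul_add, Matrix.add_mul]
  abel

/-- **LEAF (L) FROM THE GAFFNEY PAIRING (P-W) IN THE MASTER CURRENCY, (R-loc), AND (P-mass) BY NAME** (`2 ≤ L`, `0 < a`, `0 < a′`,
`(√L)⁻¹ ≤ θ`): `‖G̃_{k+1}·JpR k − JpR k·G̃_k‖ ≤ ClW·θ^k`. [folklore] -/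
theorem hloc_of_WPairing (hL : 2 ≤ L) (hbox : IsCoordBox M S) (ha : 0 < a) (ha' : 0 < a') {θ CW CH : ℝ} (hθ : (Real.sqrt L)⁻¹ ≤ θ)
    {εW : ℕ → ℝ} (hεW : ∀ k, 0 ≤ εW k) (hrate : ∀ k, εW k ≤ CW * θ ^ k)
    (hPW : ∀ (k : ℕ) (u : pidx L M (starP L M S) k → ℂ) (v : pidx L M (starP L M S) (k + 1) → ℂ),
      ‖star v ⬝ᵥ ((JpR L M (starP L M S) k * regionDeltaLoc (lev L k) M 0 S
          - regionDeltaLoc (lev L (k + 1)) M 0 S * JpR L M (starP L M S) k) *ᵥ u)‖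
        ≤ εW k * Real.sqrt (Ebud (lev L k) M a S u) * Real.sqrt (Ebud (lev L (k + 1)) M a S v))
    (hRH : ∀ (k : ℕ) (f : pidx L M (starP L M S) k → ℂ),
      ∑ μ, nsq (Wdir (lev L k) M S μ *ᵥ ((regionDeltaLoc (lev L k) M a S)⁻¹ *ᵥ f)) ≤ CH ^ 2 * nsq f) (k : ℕ) :
    ‖(regionDeltaLoc (lev L (k + 1)) M a S)⁻¹ * JpR L M (starP L M S) k
        - JpR L M (starP L M S) k * (regionDeltaLoc (lev L k) M a S)⁻¹‖ ≤ ClW d a a' CW CH * θ ^ k := by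
  have hc := cW1box_pos (d := d) a a' (Cf := 4) ha ha'
  have hγ : 0 < gamStar d a' (cW1box d a a' 4) := gamStar_pos (d := d) a' hc
  have hco := fun j => (coercive_regionDeltaLoc_lev_box L M S a a' hL hbox ha ha' j).1
  have hsθ : ∀ j : ℕ, ((Real.sqrt L)⁻¹) ^ j ≤ θ ^ j := fun j => pow_le_pow_left₀ (inv_nonneg.mpr (Real.sqrt_nonneg _)) hθ j
  -- (R̃): the master budget and the `nsq` budget of the mass part
  have hRE : ∀ (j : ℕ) (f : pidx L M (starP L M S) j → ℂ),
      Real.sqrt (Ebud (lev L j) M a S ((regionDeltaLoc (lev L j) M a S)⁻¹ *ᵥ f)) ≤ LamLoc d a a' CH * Real.sqrt (nsq f) :=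
    fun j f => budget_Ebud (lev L j) M a S ha' hγ (hco j) (hRH j) f
  have hRn : ∀ (j : ℕ) (f : pidx L M (starP L M S) j → ℂ),
      Real.sqrt (nsq ((regionDeltaLoc (lev L j) M a S)⁻¹ *ᵥ f)) ≤ (gamStar d a' (cW1box d a a' 4))⁻¹ * Real.sqrt (nsq f) := by
    intro j f
    have hG := (opNorm_inv_regionDeltaLoc_lev_box_le L M S a a' hL hbox ha ha' j).2
    rw [← Real.sqrt_sq (inv_nonneg.mpr hγ.le), ← Real.sqrt_mul (sq_nonneg _)]
    exact Real.sqrt_le_sqrt ((nsq_mulVec_le _ f).trans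
      (mul_le_mul_of_nonneg_right (pow_le_pow_left₀ (norm_nonneg _) hG 2) (nsq_nonneg f)))
  -- (P̃) = (P-W) + (P-mass)
  have hP : ∀ (j : ℕ) (u : pidx L M (starP L M S) j → ℂ) (v : pidx L M (starP L M S) (j + 1) → ℂ),
      ‖star v ⬝ᵥ ((JpR L M (starP L M S) j * regionDeltaLoc (lev L j) M a S
          - regionDeltaLoc (lev L (j + 1)) M a S * JpR L M (starP L M S) j) *ᵥ u)‖
        ≤ (εW j + 4 * a * ((Real.sqrt L)⁻¹) ^ j) * Real.sqrt (Ebud (lev L j) M a S u + nsq u)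
            * Real.sqrt (Ebud (lev L (j + 1)) M a S v + nsq v) := by
    intro j u v
    rw [loc_comm_eq]
    exact pairing_add _ _ (fun u => Ebud_nonneg (lev L j) M a S ha.le u) (fun u => nsq_nonneg u)
      (fun v => Ebud_nonneg (lev L (j + 1)) M a S ha.le v) (fun v => nsq_nonneg v) (hεW j) (by positivity)
      (hPW j) (fun u v => mass_pairing_le L M S a ha.le j u v) u v
  have hR : ∀ (j : ℕ) (f : pidx L M (starP L M S) j → ℂ),
      Real.sqrt (Ebud (lev L j) M a S ((regionDeltaLoc (lev L j) M a S)⁻¹ *ᵥ f) + nsq ((regionDeltaLoc (lev L j) M a S)⁻¹ *ᵥ f))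
        ≤ (LamLoc d a a' CH + (gamStar d a' (cW1box d a a' 4))⁻¹) * Real.sqrt (nsq f) :=
    fun j f => budget_add (fun u => Ebud_nonneg (lev L j) M a S ha.le u) (fun u => nsq_nonneg u)
      (fun f => (regionDeltaLoc (lev L j) M a S)⁻¹ *ᵥ f) (hRE j) (hRn j) f
  have hΛ0 : 0 ≤ LamLoc d a a' CH + (gamStar d a' (cW1box d a a' 4))⁻¹ :=
    add_nonneg (Real.sqrt_nonneg _) (inv_nonneg.mpr hγ.le)
  refine hloc_of_pairing L M S a a' hL hbox ha ha' (ε := fun j => εW j + 4 * a * ((Real.sqrt L)⁻¹) ^ j)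
    (Λ := fun _ => LamLoc d a a' CH + (gamStar d a' (cW1box d a a' 4))⁻¹)
    (Λ' := fun _ => LamLoc d a a' CH + (gamStar d a' (cW1box d a a' 4))⁻¹)
    (fun j => by have := hεW j; positivity) (fun _ => hΛ0) (fun _ => hΛ0) hP hR (fun j g => hR (j + 1) g) (fun j => ?_) k
  -- the rate: `(εW j + 4a(√L)^{−j})·Λ² ≤ ClW·θ^j`
  have h1 : εW j + 4 * a * ((Real.sqrt L)⁻¹) ^ j ≤ (CW + 4 * a) * θ ^ j := by
    have := hrate j
    have := mul_le_mul_of_nonneg_left (hsθ j) (by positivity : (0 : ℝ) ≤ 4 * a)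
    nlinarith
  have h0 : 0 ≤ εW j + 4 * a * ((Real.sqrt L)⁻¹) ^ j := by have := hεW j; positivity
  calc (εW j + 4 * a * ((Real.sqrt L)⁻¹) ^ j) * (LamLoc d a a' CH + (gamStar d a' (cW1box d a a' 4))⁻¹)
        * (LamLoc d a a' CH + (gamStar d a' (cW1box d a a' 4))⁻¹)
      ≤ ((CW + 4 * a) * θ ^ j) * (LamLoc d a a' CH + (gamStar d a' (cW1box d a a' 4))⁻¹)
        * (LamLoc d a a' CH + (gamStar d a' (cW1box d a a' 4))⁻¹) := by gcongr
    _ = ClW d a a' CW CH * θ ^ j := by unfold ClW; ring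

/-! ## §3 Leaf (K) is a theorem; the END modulo (P-W), (R-loc), (B), (Bᵗ) -/

/-- the constant of leaf (K) on boxes (leaf-01-g10's, written out). [folklore] -/
def CKbox (d L : ℕ) (a' : ℝ) : ℝ := ((sigma0 d a') ^ 2)⁻¹ * ((sigma0 d a') ^ 2)⁻¹ * (2 * (gammaPs d a')⁻¹ * Cbox d L a')

/-- **LEAF (K) IS A THEOREM ON COORDINATE BOXES** (leaf-01-g10 `RegionGramTwoLevel.opNorm_KcompR_inv_sub_le_lev`, rate `L⁻¹`), re-read at every
rate `θ ≥ L⁻¹`. [folklore] -/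
theorem hK_box (hbox : IsCoordBox M S) (ha' : 0 < a') {θ : ℝ} (hθ : ((L : ℝ))⁻¹ ≤ θ) (k : ℕ) :
    ‖(KcompR (lev L (k + 1)) M a' S)⁻¹ - (KcompR (lev L k) M a' S)⁻¹‖ ≤ CKbox d L a' * θ ^ k := by
  have h := opNorm_KcompR_inv_sub_le_lev (M := M) (a' := a') (S := S) L hbox ha' k
  refine h.trans ?_
  unfold CKbox
  exact mul_le_mul_of_nonneg_left (pow_le_pow_left₀ (inv_nonneg.mpr (Nat.cast_nonneg L)) hθ k) (Cgram_nonneg (d := d) a' L)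

omit [NeZero L] in
/-- `(√L)⁻¹ ≤ θ` gives `L⁻¹ ≤ θ` (`1 ≤ L`). [folklore] -/
theorem inv_le_of_sqrt_inv_le (hL : 1 ≤ L) {θ : ℝ} (hθ : (Real.sqrt L)⁻¹ ≤ θ) : ((L : ℝ))⁻¹ ≤ θ := by
  have hL1 : (1 : ℝ) ≤ L := by exact_mod_cast hL
  have hs : Real.sqrt L ≤ L := by nlinarith [Real.mul_self_sqrt (le_trans zero_le_one hL1), Real.one_le_sqrt.mpr hL1]
  have hs0 : 0 < Real.sqrt L := Real.sqrt_pos.mpr (lt_of_lt_of_le one_pos hL1)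
  exact le_trans (inv_anti₀ hs0 hs) hθ

/-- **THE RENORMALISED STAR TOWER OF THE FAITHFUL `Δ_a(Ω₀)` ON A COORDINATE BOX AT RATE `θ ∈ [(√L)⁻¹, 1)` MODULO EXACTLY (P-W), (R-loc),
(B), (Bᵗ)** — O15-a's END with (L) assembled by `hloc_of_WPairing` and (K) discharged by `hK_box`. [folklore] -/
theorem towerLimitRate_star_renorm_box_of_WPairing (hL : 2 ≤ L) (hbox : IsCoordBox M S) (ha : 0 < a) (ha' : 0 < a')
    {θ CW CH Cb Cbt : ℝ} (hθ : (Real.sqrt L)⁻¹ ≤ θ) (hθ1 : θ < 1)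
    {εW : ℕ → ℝ} (hεW : ∀ k, 0 ≤ εW k) (hrate : ∀ k, εW k ≤ CW * θ ^ k)
    (hPW : ∀ (k : ℕ) (u : pidx L M (starP L M S) k → ℂ) (v : pidx L M (starP L M S) (k + 1) → ℂ),
      ‖star v ⬝ᵥ ((JpR L M (starP L M S) k * regionDeltaLoc (lev L k) M 0 S
          - regionDeltaLoc (lev L (k + 1)) M 0 S * JpR L M (starP L M S) k) *ᵥ u)‖
        ≤ εW k * Real.sqrt (Ebud (lev L k) M a S u) * Real.sqrt (Ebud (lev L (k + 1)) M a S v))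
    (hRH : ∀ (k : ℕ) (f : pidx L M (starP L M S) k → ℂ),
      ∑ μ, nsq (Wdir (lev L k) M S μ *ᵥ ((regionDeltaLoc (lev L k) M a S)⁻¹ *ᵥ f)) ≤ CH ^ 2 * nsq f)
    (hCb : 0 ≤ Cb)
    (hB : ∀ k, ‖regionBh (lev L (k + 1)) M a' S - JpR L M (starP L M S) k * regionBh (lev L k) M a' S‖ ≤ Cb * θ ^ k)
    (hBt : ∀ k, ‖(JpR L M (starP L M S) k)ᴴ * regionBh (lev L (k + 1)) M a' S - regionBh (lev L k) M a' S‖ ≤ Cbt * θ ^ k) :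
    TowerLimitRate (AnR L M (starP L M S)) ((L : ℝ) ^ d) (fun k => (regionDeltaA (lev L k) M a a' S)⁻¹)
      (Cpert 0 (Real.sqrt (CgIbox d a' (cW1box d a a' 4) / 2 * (gamStar d a' (cW1box d a a' 4))⁻¹))
        (Real.sqrt L * C1loc d a a' (ClW d a a' CW CH) Cb Cbt (CKbox d L a') + (2 * (Real.sqrt L - 1)
          * Real.sqrt ((2 * (gamStar d a' (cW1box d a a' 4))⁻¹ + CgIbox d a' (cW1box d a a' 4)) * (gamStar d a' (cW1box d a a' 4))⁻¹))) 0 0 0) θ :=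
  towerLimitRate_star_renorm_box_of_local L M S a a' hL hbox ha ha' hθ hθ1 hCb
    (hloc_of_WPairing L M S a a' hL hbox ha ha' hθ hεW hrate hPW hRH) hB hBt
    (hK_box L M S a' hbox ha' (inv_le_of_sqrt_inv_le L (le_trans (by norm_num) hL) hθ))

end Tower

end Summit.QuantumFields.BalabanUV.T4Continuum.RegionLocalInjectedAssembly

end
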